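import Literature.Computability.FineGrained.SerfSNP
import Literature.Computability.FineGrained.SerfKSatMachine
import Literature.Computability.FineGrained.SparsificationAlgorithm
import HarnessLib

/-!
# `k`-SAT with parameter `n` SERF-reduces to `k`-SAT with parameter `m` (discharge)

Sibling proof file of `SerfSNP.lean` (D-0014: a named fact `def X : Prop` is discharged as
`theorem X_holds : X`; the sibling `SerfSNPProofs.lean` discharges the converse direction). It
discharges

* `Literature.Computability.FineGrained.serfReducible_kSATParam_kSATClauseParam_holds :
  serfReducible_kSATParam_kSATClauseParam` — for every `k`, `SERFReducible (kSATParam k) (kSATClauseParam k)`.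

Source: Impagliazzo–Paturi–Zane, *Which problems have strongly exponential complexity?*, JCSS 63
(2001), §2, Corollary 1 (the sparsification lemma: "for all `ε > 0`, a `k`-CNF `F` can be written as
the disjunction of at most `2^{εn}` `k`-CNFs `Fᵢ` with at most `C(k, ε) n` clauses each; moreover this
disjunction can be computed in time `poly(n) 2^{εn}`") and its use in §2 (proof of Corollary 2 /
Theorem "k-SAT with parameter `n` and with parameter `m` are SERF-equivalent"): the SERF reduction
from parameter `n` to parameter `m` runs the sparsifier and queries the sparse formulas `Fᵢ`, whose
parameter `m ≤ C n` is linear in `n`, accepting iff one of them is satisfiable.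

## The proof

The combinatorial and the algorithmic content are the tree's `sparsification_holds`
(`SparsificationAlgorithm.lean`: the function `F`, the bounds, and a `TM2` machine computing
`KCNF.encode φ ↦ KCNF.encodeList (F φ)` in time `T(n, L)`, `IsExpPolyBound ε T`) and
`Compaction.kCNF_compact_computable_holds` (renaming the occurring variables onto an initial
segment in polynomial time, so that every sparse formula has polynomial length). This file supplies the
oracle algorithm and checks the five clauses of `SERFReducible`:

* the step function `SerfKSat.stepFn k F` — on a code `x` of a `k`-CNF (`SerfKSat.Good`), query the
  Boolean codes of the sparse formulas of the compacted formula one after the other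
  (`SerfKSat.qs`), then answer "some oracle answer was `true`"; on any other string answer `false` —
  whose tagged code is the output `SerfKSat.stepBits` of the step machine of
  `SerfKSatMachine.lean` (`SerfKSat.encode_stepFn`, `SerfKSat.exists_stepMachine`);
* its runs and transcripts (`SerfKSat.run_alg_good`, `SerfKSat.queries_alg_good`, `…_bad`);
* correctness: some sparse formula of the compaction is satisfiable iff `x ∈ kSAT k`
  (`SerfKSat.exists_sat_sparse_iff`, by `sparsification_holds` and `KCNF.satisfiable_compact_iff`);
* the bounds: `≤ 2^{εn} + 1` rounds, step time `poly(|x|) + A · T(n', L') + A · |transcript|` with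
  `n' ≤ n` (`SerfKSat.numVars_compact_kcnfOf_le`) and `L'` polynomial, query parameter
  `m ≤ C(k, ε) n' ≤ C n`, query length polynomial.

## References

* R. Impagliazzo, R. Paturi, F. Zane, *Which problems have strongly exponential complexity?*,
  J. Comput. System Sci. 63 (2001) 512–530, §2, Corollary 1, Corollary 2. [ImpagliazzoPaturiZane2001]
* S. Arora, B. Barak, *Computational Complexity: A Modern Approach*, CUP 2009, §1.3, §3.4.
-/

noncomputable section

namespace Literature.Computability.FineGrained

open _root_.Computability Complexity Cryptography

namespace SerfKSat

variable (k : ℕ) (F : KCNF k → List (KCNF k))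

/-! ### The oracle algorithm -/

/-- The queries on input `x`: the Boolean CNF codes of the sparse formulas. [cite: ImpagliazzoPaturiZane2001, §2, Cor. 1–2] -/
def qs (x : List Bool) : List (List Bool) := (sparse k F x).map fun ψ => encodingCNF.encode ψ.clauses

/-- **The step function of the SERF reduction**: on a good input, the next query while queries are
left, then the answer "some oracle answer was `true`"; on a bad input, the answer `false`.
[cite: ImpagliazzoPaturiZane2001, §2, Cor. 1–2] -/
def stepFn (x : List Bool) (as : List (List Bool)) : List Bool ⊕ Bool :=
  if Good k x then
    match (qs k F x)[as.length]? with
    | some q => Sum.inl q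
    | none => Sum.inr (decide (true ∈ heads as))
  else Sum.inr false

/-- The oracle algorithm of the SERF reduction. [cite: ImpagliazzoPaturiZane2001, §2, Cor. 1–2] -/
def alg : OracleAlg Bool := ⟨stepFn k F⟩

/-- The number of queries is the number of sparse formulas. [folklore] -/
theorem length_qs (x : List Bool) : (qs k F x).length = (sparse k F x).length := List.length_map _

/-- **The tagged code of the step is the output of the step machine.** [folklore] -/
theorem encode_stepFn (x : List Bool) (as : List (List Bool)) :
    ((encodingList Bool).sumBool encodingBoolBool).encode (stepFn k F x as) = stepBits k F x as := by
  unfold stepFn stepBits Post.postOut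
  by_cases hg : Good k x
  · simp only [hg, if_true, decide_true]
    by_cases h : as.length < (sparse k F x).length
    · have e : (qs k F x)[as.length]? = some (encodingCNF.encode ((sparse k F x)[as.length]).clauses) := by
        rw [qs, List.getElem?_map, List.getElem?_eq_getElem h]; rfl
      rw [e, dif_pos h]; rfl
    · have e : (qs k F x)[as.length]? = none := List.getElem?_eq_none (by rw [length_qs]; omega)
      rw [e, dif_neg h]
      simp [Encoding.sumBool, encodingBoolBool, Lemma3FP.encodeBool_eq]
  · simp only [hg, if_false, decide_false]
    simp [Encoding.sumBool, encodingBoolBool, Lemma3FP.encodeBool_eq]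

/-- The runner on a good input: from the transcript of the first `r - d` answers, `d + 1` more rounds
produce the final answer. [folklore] -/
theorem runAux_alg_good {x : List Bool} (hg : Good k x) (O : Oracle) :
    ∀ (d : ℕ) (as : List (List Bool)), d ≤ (qs k F x).length →
      as = ((qs k F x).map O).take ((qs k F x).length - d) →
      (alg k F).runAux O x (d + 1) as = some (decide (true ∈ heads ((qs k F x).map O)))
  | 0, as, _, has => by
    have hl : as = (qs k F x).map O := by rw [has, Nat.sub_zero, ← List.length_map (f := O), List.take_length]
    rw [OracleAlg.runAux_succ, show (alg k F).step x as = stepFn k F x as from rfl, stepFn, if_pos hg,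
      List.getElem?_eq_none (by rw [hl, List.length_map]), hl]
  | d + 1, as, hd, has => by
    set r := (qs k F x).length with hr
    have hlen : as.length = r - (d + 1) := by rw [has, List.length_take, List.length_map]; omega
    have hlt : r - (d + 1) < r := by omega
    rw [OracleAlg.runAux_succ, show (alg k F).step x as = stepFn k F x as from rfl, stepFn, if_pos hg, hlen,
      List.getElem?_eq_getElem hlt]
    refine runAux_alg_good hg O d (as ++ [O ((qs k F x)[r - (d + 1)])]) (by omega) ?_
    rw [has, show r - d = (r - (d + 1)) + 1 by omega,
      List.take_succ_eq_append_getElem (by rw [List.length_map]; exact hlt), List.getElem_map]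

/-- **The run on a good input**: within `r + 1` rounds, the answer "some oracle answer was `true`".
[folklore] -/
theorem run_alg_good {x : List Bool} (hg : Good k x) (O : Oracle) :
    (alg k F).run O ((qs k F x).length + 1) x = some (decide (true ∈ heads ((qs k F x).map O))) :=
  runAux_alg_good k F hg O _ [] le_rfl (by simp)

/-- The transcript of queries on a good input, from round `r - d` on. [folklore] -/
theorem queriesAux_alg_good {x : List Bool} (hg : Good k x) (O : Oracle) :
    ∀ (d : ℕ) (as : List (List Bool)), d ≤ (qs k F x).length →
      as = ((qs k F x).map O).take ((qs k F x).length - d) →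
      (alg k F).queriesAux O x (d + 1) as = (qs k F x).drop ((qs k F x).length - d)
  | 0, as, _, has => by
    have hl : as = (qs k F x).map O := by rw [has, Nat.sub_zero, ← List.length_map (f := O), List.take_length]
    rw [OracleAlg.queriesAux, show (alg k F).step x as = stepFn k F x as from rfl, stepFn, if_pos hg,
      List.getElem?_eq_none (by rw [hl, List.length_map]), Nat.sub_zero, List.drop_length]
  | d + 1, as, hd, has => by
    set r := (qs k F x).length with hr
    have hlen : as.length = r - (d + 1) := by rw [has, List.length_take, List.length_map]; omega
    have hlt : r - (d + 1) < r := by omega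
    rw [OracleAlg.queriesAux, show (alg k F).step x as = stepFn k F x as from rfl, stepFn, if_pos hg, hlen,
      List.getElem?_eq_getElem hlt]
    simp only
    rw [queriesAux_alg_good hg O d (as ++ [O ((qs k F x)[r - (d + 1)])]) (by omega) ?_,
      show r - d = (r - (d + 1)) + 1 by omega, List.drop_eq_getElem_cons hlt]
    rw [has, show r - d = (r - (d + 1)) + 1 by omega,
      List.take_succ_eq_append_getElem (by rw [List.length_map]; exact hlt), List.getElem_map]

/-- **The queries on a good input**: exactly the codes of the sparse formulas. [folklore] -/
theorem queries_alg_good {x : List Bool} (hg : Good k x) (O : Oracle) :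
    (alg k F).queries O ((qs k F x).length + 1) x = qs k F x := by
  have := queriesAux_alg_good k F hg O _ [] le_rfl (by simp)
  rw [OracleAlg.queries]
  simpa using this

/-- The run on a bad input: the answer `false` at once. [folklore] -/
theorem run_alg_bad {x : List Bool} (hg : ¬ Good k x) (O : Oracle) (n : ℕ) : (alg k F).run O (n + 1) x = some false := by
  rw [OracleAlg.run, OracleAlg.runAux_succ, show (alg k F).step x [] = stepFn k F x [] from rfl, stepFn, if_neg hg]

/-- No query on a bad input. [folklore] -/
theorem queries_alg_bad {x : List Bool} (hg : ¬ Good k x) (O : Oracle) (n : ℕ) : (alg k F).queries O n x = [] := by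
  cases n with
  | zero => rfl
  | succ n => rw [OracleAlg.queries, OracleAlg.queriesAux, show (alg k F).step x [] = stepFn k F x [] from rfl, stepFn, if_neg hg]

/-! ### Parameters -/

/-- The parameter of `kSATParam k` through the total decoder: `numVars` of the decoded CNF on codes,
`0` on non-codes. [folklore] -/
theorem kSATParam_param (x : List Bool) :
    (kSATParam k).param x = if encodingCNF.encode (NegCNF.decCNF x) = x then (NegCNF.decCNF x).numVars else 0 := by
  simp only [kSATParam, ParamProblem.ofEncoding, NegCNF.decode_cnf]

/-- **The compacted formula has at most `n` variables**, `n` the parameter of the input: its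
variables are the occurring variables of the decoded CNF, which are `< CNF.numVars`. [folklore] -/
theorem numVars_compact_kcnfOf_le (x : List Bool) : (KCNF.compact (kcnfOf k x)).numVars ≤ (kSATParam k).param x := by
  rw [KCNF.numVars_compact, kSATParam_param]
  by_cases hg : Good k x
  · rw [kcnfOf_clauses_of_good hg, if_pos hg.1]
    calc (IPRename.occVars (NegCNF.decCNF x)).card ≤ (Finset.range (NegCNF.decCNF x).numVars).card := by
          refine Finset.card_le_card fun v hv => ?_
          obtain ⟨c, hc, hv⟩ := IPRename.mem_occVars.1 hv
          obtain ⟨l, hl, rfl⟩ := IPRename.occursIn_eq_true.1 hv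
          exact Finset.mem_range.2 (CNF.lt_numVars_of_mem_of_mem hc hl)
      _ = _ := Finset.card_range _
  · rw [kcnfOf_clauses_of_not_good hg]
    simp [IPRename.occVars]

/-- The compacted formula has at most `2|x| + 3` variables. [folklore] -/
theorem numVars_compact_kcnfOf_le_length (x : List Bool) : (KCNF.compact (kcnfOf k x)).numVars ≤ 2 * x.length + 3 :=
  (KCNF.numVars_compact_le_length_encode _).trans (length_encode_kcnfOf_le k x)

/-- The compacted formula has polynomial length: `≤ (k + 3) (2|x| + 5)²`. [folklore] -/
theorem length_encode_compact_kcnfOf_le (x : List Bool) :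
    (KCNF.compact (kcnfOf k x)).encode.length ≤ (k + 3) * (2 * x.length + 5) ^ 2 :=
  (KCNF.length_encode_compact_le _).trans (Nat.mul_le_mul_left _ (Nat.pow_le_pow_left (by
    have := length_encode_kcnfOf_le k x; omega) 2))

/-! ### Correctness -/

/-- **Some sparse formula of the compaction is satisfiable iff the input is in `kSAT k`** (for a good
input): sparsification preserves the set of satisfying assignments, compaction preserves
satisfiability, and a good input is in `kSAT k` iff its decoded CNF is satisfiable.
[cite: ImpagliazzoPaturiZane2001, §2, Cor. 1 ("F = ⋁ᵢ Fᵢ")] -/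
theorem exists_sat_sparse_iff {x : List Bool} (hg : Good k x)
    (hF : ∀ φ : KCNF k, ∀ v : ℕ → Bool, φ.eval v = true ↔ ∃ ψ ∈ F φ, ψ.eval v = true) :
    (∃ ψ ∈ sparse k F x, CNF.Satisfiable ψ.clauses) ↔ x ∈ kSAT k := by
  rw [mem_kSAT_iff_of_good hg, ← kcnfOf_clauses_of_good hg]
  constructor
  · rintro ⟨ψ, hψ, v, hv⟩
    have h1 : (KCNF.compact (kcnfOf k x)).eval v = true := (hF _ v).2 ⟨ψ, hψ, hv⟩
    rw [KCNF.eval_compact] at h1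
    exact ⟨fun i => v ((kcnfOf k x).rank i), h1⟩
  · rintro ⟨v, hv⟩
    have h1 : (KCNF.compact (kcnfOf k x)).eval ((kcnfOf k x).pull v) = true := by
      rw [KCNF.eval_compact_pull]; exact hv
    obtain ⟨ψ, hψ, h2⟩ := (hF _ _).1 h1
    exact ⟨ψ, hψ, (kcnfOf k x).pull v, h2⟩

/-- The head bit of the oracle answer to the code of a sparse formula is its satisfiability. [folklore] -/
theorem headD_oracle_encode_eq_true_iff (ψ : KCNF k) :
    (Oracle.ofLanguage (kSAT k) (encodingCNF.encode ψ.clauses)).headD false = true ↔ CNF.Satisfiable ψ.clauses := by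
  rw [Oracle.ofLanguage_apply, Lemma3FP.encodeBool_eq, List.headD_cons, ← Set.mem_iff_boolIndicator]
  exact (mem_kSAT_iff k ψ.clauses).trans ⟨fun h => h.2, fun h => ⟨ψ.length_le, h⟩⟩

/-- **The answer of the run on a good input is membership in `kSAT k`.** [cite: ImpagliazzoPaturiZane2001, §2, Cor. 1–2] -/
theorem answer_eq_boolIndicator {x : List Bool} (hg : Good k x)
    (hF : ∀ φ : KCNF k, ∀ v : ℕ → Bool, φ.eval v = true ↔ ∃ ψ ∈ F φ, ψ.eval v = true) :
    decide (true ∈ heads ((qs k F x).map (Oracle.ofLanguage (kSAT k)))) = (kSAT k).boolIndicator x := by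
  have key : true ∈ heads ((qs k F x).map (Oracle.ofLanguage (kSAT k))) ↔ x ∈ kSAT k := by
    rw [← exists_sat_sparse_iff k F hg hF]
    simp only [heads, qs, List.map_map, List.mem_map, Function.comp_apply, headD_oracle_encode_eq_true_iff]
  by_cases h : x ∈ kSAT k
  · rw [decide_eq_true (key.2 h)]; exact ((Set.mem_iff_boolIndicator _ _).1 h).symm
  · rw [decide_eq_false (fun h' => h (key.1 h'))]; exact ((Set.notMem_iff_boolIndicator _ _).1 h).symm

end SerfKSat

/-! ### The discharge -/

open SerfKSat in
/-- **Discharge of `serfReducible_kSATParam_kSATClauseParam`** (Impagliazzo–Paturi–Zane 2001, §2,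
Corollary 1 with its use for Corollary 2: sparsification gives a SERF reduction from `k`-SAT with
parameter `n`, the number of variables, to `k`-SAT with parameter `m`, the number of clauses). Given
`ε > 0`, the oracle algorithm `SerfKSat.alg k F` for the sparsifier `F` of `sparsification_holds k ε`
queries the (Boolean codes of the) at most `2^{εn}` sparse formulas of the compacted input formula,
each with `m ≤ C(k, ε) · n` clauses and of polynomial length, and accepts iff one of them is
satisfiable; its step function is computed by the machine of `SerfKSat.exists_stepMachine` in time
`poly(|x|) + O(T(n, poly |x|)) + O(|transcript|)`, `T` the `2^{εn} poly` running time of the sparsifier.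
[cite: ImpagliazzoPaturiZane2001, §2, Corollary 1–2] -/
theorem serfReducible_kSATParam_kSATClauseParam_holds : serfReducible_kSATParam_kSATClauseParam := by
  intro k ε hε
  classical
  obtain ⟨Csp, F, T, hFprop, ⟨cT, hcT⟩, hFm⟩ := sparsification_holds k ε hε
  obtain ⟨Ms, hMs⟩ := exists_computesInTime_iff.2 hFm
  obtain ⟨N, A, hN⟩ := exists_stepMachine k F (fun φ => T φ.numVars φ.encode.length) ⟨Ms, hMs⟩
  -- the data of the reduction
  let fuel : List Bool → ℕ := fun x => (qs k F x).length + 1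
  let Tstep : List Bool × List (List Bool) → ℕ := fun q =>
    A * (q.1.length + 1) ^ A + A * T (KCNF.compact (kcnfOf k q.1)).numVars (KCNF.compact (kcnfOf k q.1)).encode.length +
      A * ((encodingList Bool).listBool.encode q.2).length
  let B : ℕ := 25 * (k + 4)
  let cS : ℕ := A + A * cT * B ^ cT + A + (A + 2 * cT)
  let C : ℕ := max (max Csp 2) (48 + 36 * Csp * (5 * k + 2))
  have hO : Oracle.ofLanguage (kSATClauseParam k).lang = Oracle.ofLanguage (kSAT k) := rfl
  refine ⟨alg k F, fuel, Tstep, C, ⟨2, fun x => ?_⟩, ⟨N, ?_⟩, ⟨cS, fun x as => ?_⟩, fun x => ?_, fun x q hq => ?_⟩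
  · -- (1) at most `2^{εn} + 1` rounds
    have h1 : ((F (KCNF.compact (kcnfOf k x))).length : ℝ) ≤ (2 : ℝ) ^ (ε * ((KCNF.compact (kcnfOf k x)).numVars : ℝ)) :=
      (hFprop _).1
    have en := numVars_compact_kcnfOf_le k x
    show ((((sparse k F x).map fun ψ => encodingCNF.encode ψ.clauses).length + 1 : ℕ) : ℝ) ≤
      ((2 : ℕ) : ℝ) * (2 : ℝ) ^ (ε * ((kSATParam k).param x : ℝ)) * ((x.length : ℝ) + 1) ^ (2 : ℕ)
    rw [List.length_map]
    unfold sparse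
    generalize KCNF.compact (kcnfOf k x) = φ' at h1 en ⊢
    generalize (kSATParam k).param x = pm at en ⊢
    generalize (F φ').length = r at h1 ⊢
    generalize φ'.numVars = nv at en h1
    generalize x.length = L
    have h2 : (2 : ℝ) ^ (ε * (nv : ℝ)) ≤ (2 : ℝ) ^ (ε * (pm : ℝ)) :=
      Real.rpow_le_rpow_of_exponent_le one_le_two (mul_le_mul_of_nonneg_left (by exact_mod_cast en) hε.le)
    have h3 : (1 : ℝ) ≤ (2 : ℝ) ^ (ε * (pm : ℝ)) := Real.one_le_rpow one_le_two (by positivity)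
    have h4 : (1 : ℝ) ≤ ((L : ℝ) + 1) ^ (2 : ℕ) := one_le_pow₀ (by linarith [Nat.cast_nonneg (α := ℝ) L])
    push_cast
    nlinarith
  · -- (2) the step machine
    rintro ⟨x, as⟩
    have h := hN x as
    rw [← encode_stepFn] at h
    exact h
  · -- (3) the step time is within the SERF bound
    have e1 := length_encode_compact_kcnfOf_le k x
    have en := numVars_compact_kcnfOf_le k x
    have hT := hcT (KCNF.compact (kcnfOf k x)).numVars (KCNF.compact (kcnfOf k x)).encode.length
    show (((A * (x.length + 1) ^ A +
        A * T (KCNF.compact (kcnfOf k x)).numVars (KCNF.compact (kcnfOf k x)).encode.length +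
        A * ((encodingList Bool).listBool.encode as).length : ℕ)) : ℝ) ≤ _
    -- make the data opaque: only the inequalities matter from here on
    generalize KCNF.compact (kcnfOf k x) = φ' at e1 en hT ⊢
    generalize ((encodingList Bool).listBool.encode as).length = ℓ
    generalize (kSATParam k).param x = pm at en ⊢
    generalize φ'.numVars = nv at en hT ⊢
    generalize φ'.encode.length = Le at e1 hT ⊢
    generalize T nv Le = t at hT ⊢
    generalize x.length = L at e1 ⊢
    -- in `ℕ`: the compacted formula is polynomially long
    have hB : Le + 1 ≤ B * (L + 1) ^ 2 := by
      have e2 : (2 * L + 5) ^ 2 ≤ 25 * (L + 1) ^ 2 :=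
        calc (2 * L + 5) ^ 2 ≤ (5 * (L + 1)) ^ 2 := Nat.pow_le_pow_left (by omega) 2
          _ = 25 * (L + 1) ^ 2 := by ring
      have e3 : 1 ≤ 25 * (L + 1) ^ 2 := by nlinarith
      calc Le + 1 ≤ (k + 3) * (25 * (L + 1) ^ 2) + 25 * (L + 1) ^ 2 :=
            Nat.add_le_add (e1.trans (Nat.mul_le_mul_left _ e2)) e3
        _ = B * (L + 1) ^ 2 := by simp only [B]; ring
    -- in `ℝ`
    set P : ℝ := (2 : ℝ) ^ (ε * (pm : ℝ)) with hP
    set S : ℝ := (L : ℝ) + 1 with hS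
    have hP1 : 1 ≤ P := Real.one_le_rpow one_le_two (by positivity)
    have hS1 : 1 ≤ S := by simp only [hS]; linarith [Nat.cast_nonneg (α := ℝ) L]
    have hΛ1 : (1 : ℝ) ≤ (ℓ : ℝ) + 1 := by linarith [Nat.cast_nonneg (α := ℝ) ℓ]
    have hX : 0 ≤ P * S ^ cS * ((ℓ : ℝ) + 1) := by positivity
    -- (a) the polynomial part
    have ha : ((A * (L + 1) ^ A : ℕ) : ℝ) ≤ A * (P * S ^ cS * ((ℓ : ℝ) + 1)) := by
      push_cast
      rw [← hS]
      have f1 : S ^ A ≤ S ^ cS := pow_le_pow_right₀ hS1 (by simp only [cS]; omega)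
      have f2 : S ^ cS ≤ P * S ^ cS * ((ℓ : ℝ) + 1) := by
        calc S ^ cS = 1 * S ^ cS * 1 := by ring
          _ ≤ P * S ^ cS * ((ℓ : ℝ) + 1) := by gcongr
      exact mul_le_mul_of_nonneg_left (f1.trans f2) (Nat.cast_nonneg A)
    -- (b) the sparsifier part
    have hb : ((A * t : ℕ) : ℝ) ≤ (A * cT * B ^ cT : ℕ) * (P * S ^ cS * ((ℓ : ℝ) + 1)) := by
      have f2 : (2 : ℝ) ^ (ε * (nv : ℝ)) ≤ P :=
        Real.rpow_le_rpow_of_exponent_le one_le_two (mul_le_mul_of_nonneg_left (by exact_mod_cast en) hε.le)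
      have f3 : ((Le : ℝ) + 1) ≤ (B : ℝ) * S ^ 2 := by simp only [hS]; exact_mod_cast hB
      have f4 : ((Le : ℝ) + 1) ^ cT ≤ ((B : ℝ) * S ^ 2) ^ cT :=
        pow_le_pow_left₀ (by linarith [Nat.cast_nonneg (α := ℝ) Le]) f3 cT
      rw [mul_pow, ← pow_mul] at f4
      have f6 : S ^ (2 * cT) ≤ S ^ cS := pow_le_pow_right₀ hS1 (by simp only [cS]; omega)
      have f7 : ((Le : ℝ) + 1) ^ cT ≤ (B : ℝ) ^ cT * S ^ cS := f4.trans (mul_le_mul_of_nonneg_left f6 (by positivity))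
      have f8 : (t : ℝ) ≤ cT * P * ((B : ℝ) ^ cT * S ^ cS) :=
        hT.trans (by gcongr)
      push_cast
      calc (A : ℝ) * (t : ℝ) ≤ A * (cT * P * ((B : ℝ) ^ cT * S ^ cS)) := mul_le_mul_of_nonneg_left f8 (Nat.cast_nonneg A)
        _ = (A * cT * (B : ℝ) ^ cT) * (P * S ^ cS * 1) := by ring
        _ ≤ (A * cT * (B : ℝ) ^ cT) * (P * S ^ cS * ((ℓ : ℝ) + 1)) := by gcongr
    -- (c) the transcript part
    have hc : ((A * ℓ : ℕ) : ℝ) ≤ A * (P * S ^ cS * ((ℓ : ℝ) + 1)) := by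
      push_cast
      refine mul_le_mul_of_nonneg_left ?_ (Nat.cast_nonneg A)
      calc (ℓ : ℝ) ≤ 1 * 1 * ((ℓ : ℝ) + 1) := by linarith
        _ ≤ P * S ^ cS * ((ℓ : ℝ) + 1) := by gcongr; exact one_le_pow₀ hS1
    have hcS : ((A : ℝ) + (A * cT * B ^ cT : ℕ) + A) ≤ (cS : ℝ) := by
      have : A + A * cT * B ^ cT + A ≤ cS := by simp only [cS]; omega
      exact_mod_cast this
    calc (((A * (L + 1) ^ A + A * t + A * ℓ : ℕ)) : ℝ)
        = ((A * (L + 1) ^ A : ℕ) : ℝ) + ((A * t : ℕ) : ℝ) + ((A * ℓ : ℕ) : ℝ) := by push_cast; ring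
      _ ≤ A * (P * S ^ cS * ((ℓ : ℝ) + 1)) + (A * cT * B ^ cT : ℕ) * (P * S ^ cS * ((ℓ : ℝ) + 1)) +
          A * (P * S ^ cS * ((ℓ : ℝ) + 1)) := add_le_add (add_le_add ha hb) hc
      _ = ((A : ℝ) + (A * cT * B ^ cT : ℕ) + A) * (P * S ^ cS * ((ℓ : ℝ) + 1)) := by ring
      _ ≤ (cS : ℝ) * (P * S ^ cS * ((ℓ : ℝ) + 1)) := mul_le_mul_of_nonneg_right hcS hX
      _ = (cS : ℝ) * P * S ^ cS * ((ℓ : ℝ) + 1) := by ring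
  · -- (4) the run decides `kSAT k`
    rw [hO]
    show (alg k F).run (Oracle.ofLanguage (kSAT k)) ((qs k F x).length + 1) x = some ((kSAT k).boolIndicator x)
    by_cases hg : Good k x
    · rw [run_alg_good k F hg, answer_eq_boolIndicator k F hg (fun φ => (hFprop φ).2.2)]
    · rw [run_alg_bad k F hg, (Set.notMem_iff_boolIndicator _ _).1 (not_mem_kSAT_of_not_good hg)]
  · -- (5) the queries: parameter `m ≤ C · n`, polynomial length
    rw [hO] at hq
    change q ∈ (alg k F).queries (Oracle.ofLanguage (kSAT k)) ((qs k F x).length + 1) x at hq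
    by_cases hg : Good k x
    · rw [queries_alg_good k F hg] at hq
      obtain ⟨ψ, hψ, rfl⟩ := List.mem_map.1 hq
      obtain ⟨hn', hm⟩ := (hFprop (KCNF.compact (kcnfOf k x))).2.1 ψ hψ
      constructor
      · -- the parameter
        rw [kSATClauseParam_param_encode]
        calc CNF.numClauses ψ.clauses = ψ.clauses.length := rfl
          _ ≤ Csp * (KCNF.compact (kcnfOf k x)).numVars := hm
          _ ≤ Csp * (kSATParam k).param x := Nat.mul_le_mul_left _ (numVars_compact_kcnfOf_le k x)
          _ ≤ C * (kSATParam k).param x := Nat.mul_le_mul_right _ ((le_max_left _ _).trans (le_max_left _ _))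
      · -- the length
        have e1 := Post.length_encode_clauses_le ψ.numVars ψ.clauses
        rw [← encode_eq_kword] at e1
        have e2 := KCNF.length_encode_le ψ
        have e3 : ψ.numVars ≤ 2 * x.length + 3 := hn' ▸ numVars_compact_kcnfOf_le_length k x
        have e4 : ψ.clauses.length ≤ Csp * (2 * x.length + 3) := hm.trans (Nat.mul_le_mul_left _ (numVars_compact_kcnfOf_le_length k x))
        have e5 : (encodingCNF.encode ψ.clauses).length ≤ (48 + 36 * Csp * (5 * k + 2)) * (x.length + 1) ^ 2 := by
          set S := x.length + 1 with hS
          have f1 : ψ.numVars + 1 ≤ 4 * S := by omega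
          have f2 : k * (ψ.numVars + 2) + 2 ≤ (5 * k + 2) * S := by
            have g1 : ψ.numVars + 2 ≤ 5 * S := by omega
            have g2 : 2 ≤ 2 * S := by omega
            calc k * (ψ.numVars + 2) + 2 ≤ k * (5 * S) + 2 * S := Nat.add_le_add (Nat.mul_le_mul_left k g1) g2
              _ = (5 * k + 2) * S := by ring
          have f3 : ψ.clauses.length ≤ Csp * (3 * S) := e4.trans (Nat.mul_le_mul_left _ (by omega))
          have f4 : ψ.clauses.length * (k * (ψ.numVars + 2) + 2) ≤ 3 * Csp * (5 * k + 2) * S ^ 2 :=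
            calc ψ.clauses.length * (k * (ψ.numVars + 2) + 2) ≤ (Csp * (3 * S)) * ((5 * k + 2) * S) := Nat.mul_le_mul f3 f2
              _ = 3 * Csp * (5 * k + 2) * S ^ 2 := by ring
          have f5 : S ≤ S ^ 2 := Nat.le_self_pow two_ne_zero S
          have f6 : ψ.encode.length ≤ (4 + 3 * Csp * (5 * k + 2)) * S ^ 2 :=
            calc ψ.encode.length ≤ ψ.numVars + 1 + ψ.clauses.length * (k * (ψ.numVars + 2) + 2) := e2
              _ ≤ 4 * S ^ 2 + 3 * Csp * (5 * k + 2) * S ^ 2 :=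
                  Nat.add_le_add (f1.trans (Nat.mul_le_mul_left 4 f5)) f4
              _ = (4 + 3 * Csp * (5 * k + 2)) * S ^ 2 := by ring
          calc (encodingCNF.encode ψ.clauses).length ≤ 12 * ψ.encode.length := e1
            _ ≤ 12 * ((4 + 3 * Csp * (5 * k + 2)) * S ^ 2) := Nat.mul_le_mul_left 12 f6
            _ = (48 + 36 * Csp * (5 * k + 2)) * S ^ 2 := by ring
        calc (encodingCNF.encode ψ.clauses).length ≤ (48 + 36 * Csp * (5 * k + 2)) * (x.length + 1) ^ 2 := e5
          _ ≤ C * (x.length + 1) ^ C := Nat.mul_le_mul (le_max_right _ _)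
              (Nat.pow_le_pow_right (Nat.succ_pos _) ((le_max_right _ _).trans (le_max_left _ _)))
    · rw [queries_alg_bad k F hg] at hq
      simp at hq

end Literature.Computability.FineGrained
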